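import Summits.Parity.GeneralizedHardyLittlewood.Theorems.LeeYangFibresRelativeDimOneArchFactsAux
import Mathlib

/-!
# Route `LeeYangFibres`, crux `RelativeDimOne` (stmt-Parity-14113), line `SketchIdeator1` =
`translate-amplification`: B4, the archimedean facts (`stub_archFacts : ArchFacts`)

For a convex `I ⊆ [-N, N] ⊆ ℝ¹` (an interval) and the volumes `w(H) = vol(I ∩ ⋂_j (I − H_j))`
(`volume (meetTranslates I H)`):

* (i) `|∑_{H ∈ [-2N,2N]^m} w(H) − vol(I)^{m+1}| ≤ m 2^m (N+1)^m`: interchanging the sum over `H` with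
  the integral over the base point `y ∈ I` gives `∑_H w(H) = ∫_I c(y)^m dy`
  (`sum_volume_sections_eq_lintegral`), where `c(y) = #{h ∈ ℤ ∩ [-2N, 2N] : y + h ∈ I}` is within `1`
  of `ℓ = vol(I)` (`card_shifts_bounds` of the auxiliary file), whence
  `ℓ (ℓ-1)_+^m ≤ ∑_H w(H) ≤ ℓ (ℓ+1)^m` (`sum_volume_sections_bounds`) and one concludes with
  `a (a^m − b^m) ≤ m a^m` for `0 ≤ b ≤ a ≤ b + 1` (`mul_pow_sub_pow_le`);
* (ii) `w` is `2`-Lipschitz in each shift (`abs_volume_meetTranslates_sub_le`, from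
  `abs_toReal_volume_sections_sub_le` of the auxiliary file; the `j = 0` terms coincide).

The transfer from `Fin 1 → ℝ` to the section `J = {y | (fun _ => y) ∈ I} ⊆ ℝ` is in the auxiliary
file `LeeYangFibresRelativeDimOneArchFactsAux.lean`.
-/

noncomputable section

open scoped BigOperators Classical Topology ENNReal
open Finset Filter MeasureTheory Literature.NumberTheory.Sieve

namespace Summit.Parity.GeneralizedHardyLittlewood.Cruxes.RelativeDimOne.TranslateAmplification

variable {m : ℕ}

/-! ### One-dimensional facts: the complete sum of the lengths as an integral -/

/-- Pointwise, `∑_{H ∈ [-2N,2N]^m} 1[y ∈ ⋂_j (J − H'_j)] = 1_J(y) c(y)^m` with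
`c(y) = #{h ∈ ℤ ∩ [-2N, 2N] : y + h ∈ J}` (the sum over the box of a product factorises). -/
theorem sum_indicator_sections (J : Set ℝ) (m N : ℕ) (y : ℝ) :
    ∑ H ∈ shiftBox m N, {y : ℝ | ∀ j : Fin (m + 1), y + (shiftVec H j : ℝ) ∈ J}.indicator (1 : ℝ → ℝ≥0∞) y =
      J.indicator (fun y => ((((Finset.Icc (-(2 * N : ℤ)) (2 * N)).filter
        (fun h : ℤ => y + (h : ℝ) ∈ J)).card : ℕ) : ℝ≥0∞) ^ m) y := by
  by_cases hy : y ∈ J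
  · rw [Set.indicator_of_mem hy]
    have key : ∀ H : Fin m → ℤ,
        {y : ℝ | ∀ j : Fin (m + 1), y + (shiftVec H j : ℝ) ∈ J}.indicator (1 : ℝ → ℝ≥0∞) y =
          ∏ j : Fin m, (if y + (H j : ℝ) ∈ J then (1 : ℝ≥0∞) else 0) := by
      intro H
      rw [Fintype.prod_boole]
      by_cases hH : ∀ j : Fin m, y + (H j : ℝ) ∈ J
      · have hmem : y ∈ {y : ℝ | ∀ j : Fin (m + 1), y + (shiftVec H j : ℝ) ∈ J} := by
          simp only [Set.mem_setOf_eq, Fin.forall_fin_succ, shiftVec_zero, shiftVec_succ, Int.cast_zero,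
            add_zero]
          exact ⟨hy, hH⟩
        rw [if_pos hH, Set.indicator_of_mem hmem, Pi.one_apply]
      · have hnmem : y ∉ {y : ℝ | ∀ j : Fin (m + 1), y + (shiftVec H j : ℝ) ∈ J} := by
          simp only [Set.mem_setOf_eq, Fin.forall_fin_succ, shiftVec_zero, shiftVec_succ, Int.cast_zero,
            add_zero, not_and]
          exact fun _ => hH
        rw [if_neg hH, Set.indicator_of_notMem hnmem]
    rw [Finset.sum_congr rfl fun H _ => key H, shiftBox,
      ← Finset.sum_pow' (Finset.Icc (-(2 * N : ℤ)) (2 * N)) (fun h : ℤ => if y + (h : ℝ) ∈ J then (1 : ℝ≥0∞) else 0) m,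
      Finset.sum_boole]
  · rw [Set.indicator_of_notMem hy]
    refine Finset.sum_eq_zero fun H _ => Set.indicator_of_notMem (fun h => hy ?_) _
    simpa using h 0

/-- `∑_{H ∈ [-2N,2N]^m} vol(⋂_j (J − H'_j)) = ∫_J c(y)^m dy`. -/
theorem sum_volume_sections_eq_lintegral {J : Set ℝ} (hJm : MeasurableSet J) (m N : ℕ) :
    ∑ H ∈ shiftBox m N, volume {y : ℝ | ∀ j : Fin (m + 1), y + (shiftVec H j : ℝ) ∈ J} =
      ∫⁻ y in J, ((((Finset.Icc (-(2 * N : ℤ)) (2 * N)).filter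
        (fun h : ℤ => y + (h : ℝ) ∈ J)).card : ℕ) : ℝ≥0∞) ^ m := by
  have hMm : ∀ H : Fin m → ℤ, MeasurableSet {y : ℝ | ∀ j : Fin (m + 1), y + (shiftVec H j : ℝ) ∈ J} :=
    fun H => measurableSet_sections hJm fun j => (shiftVec H j : ℝ)
  calc ∑ H ∈ shiftBox m N, volume {y : ℝ | ∀ j : Fin (m + 1), y + (shiftVec H j : ℝ) ∈ J}
      = ∑ H ∈ shiftBox m N,
          ∫⁻ y, {y : ℝ | ∀ j : Fin (m + 1), y + (shiftVec H j : ℝ) ∈ J}.indicator (1 : ℝ → ℝ≥0∞) y :=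
        Finset.sum_congr rfl fun H _ => (lintegral_indicator_one (hMm H)).symm
    _ = ∫⁻ y, ∑ H ∈ shiftBox m N,
          {y : ℝ | ∀ j : Fin (m + 1), y + (shiftVec H j : ℝ) ∈ J}.indicator (1 : ℝ → ℝ≥0∞) y :=
        (lintegral_finsetSum _ fun H _ => measurable_one.indicator (hMm H)).symm
    _ = ∫⁻ y, J.indicator (fun y => ((((Finset.Icc (-(2 * N : ℤ)) (2 * N)).filter
          (fun h : ℤ => y + (h : ℝ) ∈ J)).card : ℕ) : ℝ≥0∞) ^ m) y :=
        lintegral_congr fun y => sum_indicator_sections J m N y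
    _ = _ := lintegral_indicator hJm _

/-- The two-sided bound `ℓ (ℓ-1)_+^m ≤ ∑_{H ∈ [-2N,2N]^m} vol(⋂_j (J − H'_j)) ≤ ℓ (ℓ+1)^m` for an
interval `J ⊆ [-N, N]` of length `ℓ`. -/
theorem sum_volume_sections_bounds {J : Set ℝ} (hJ : J.OrdConnected) {N : ℕ}
    (hJN : J ⊆ Set.Icc (-(N : ℝ)) N) (m : ℕ) :
    (volume J).toReal * max ((volume J).toReal - 1) 0 ^ m ≤
        ∑ H ∈ shiftBox m N, (volume {y : ℝ | ∀ j : Fin (m + 1), y + (shiftVec H j : ℝ) ∈ J}).toReal ∧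
      ∑ H ∈ shiftBox m N, (volume {y : ℝ | ∀ j : Fin (m + 1), y + (shiftVec H j : ℝ) ∈ J}).toReal ≤
        (volume J).toReal * ((volume J).toReal + 1) ^ m := by
  have hJm : MeasurableSet J := hJ.measurableSet
  have hvolJ : volume J ≠ ∞ := volume_ne_top_of_subset_Icc hJN
  have hfinH : ∀ H : Fin m → ℤ,
      volume {y : ℝ | ∀ j : Fin (m + 1), y + (shiftVec H j : ℝ) ∈ J} ≠ ∞ :=
    fun H => measure_ne_top_of_subset (fun y hy => by simpa using hy 0) hvolJ
  rw [← ENNReal.toReal_sum fun H _ => hfinH H, sum_volume_sections_eq_lintegral hJm m N]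
  obtain ⟨ℓ, hℓ⟩ : ∃ ℓ : ℝ, (volume J).toReal = ℓ := ⟨_, rfl⟩
  have hℓ0 : 0 ≤ ℓ := hℓ ▸ ENNReal.toReal_nonneg
  have hVℓ : volume J = ENNReal.ofReal ℓ := by rw [← hℓ, ENNReal.ofReal_toReal hvolJ]
  rw [hℓ]
  have hle : ∀ y ∈ J, ((((Finset.Icc (-(2 * N : ℤ)) (2 * N)).filter
      (fun h : ℤ => y + (h : ℝ) ∈ J)).card : ℕ) : ℝ≥0∞) ≤ ENNReal.ofReal (ℓ + 1) := by
    intro y hy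
    rw [← ENNReal.ofReal_natCast]
    exact ENNReal.ofReal_le_ofReal (hℓ ▸ (card_shifts_bounds hJ hJN hy).1)
  have hge : ∀ y ∈ J, ENNReal.ofReal (ℓ - 1) ≤ ((((Finset.Icc (-(2 * N : ℤ)) (2 * N)).filter
      (fun h : ℤ => y + (h : ℝ) ∈ J)).card : ℕ) : ℝ≥0∞) := by
    intro y hy
    rw [← ENNReal.ofReal_natCast]
    have h := (card_shifts_bounds hJ hJN hy).2
    rw [hℓ] at h
    exact ENNReal.ofReal_le_ofReal (by linarith)
  have hup : ∫⁻ y in J, ((((Finset.Icc (-(2 * N : ℤ)) (2 * N)).filter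
      (fun h : ℤ => y + (h : ℝ) ∈ J)).card : ℕ) : ℝ≥0∞) ^ m ≤ ENNReal.ofReal (ℓ + 1) ^ m * volume J := by
    calc ∫⁻ y in J, ((((Finset.Icc (-(2 * N : ℤ)) (2 * N)).filter
          (fun h : ℤ => y + (h : ℝ) ∈ J)).card : ℕ) : ℝ≥0∞) ^ m
        ≤ ∫⁻ _ in J, ENNReal.ofReal (ℓ + 1) ^ m :=
          setLIntegral_mono measurable_const fun y hy => by gcongr; exact hle y hy
      _ = ENNReal.ofReal (ℓ + 1) ^ m * volume J := setLIntegral_const _ _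
  have hlo : ENNReal.ofReal (ℓ - 1) ^ m * volume J ≤ ∫⁻ y in J, ((((Finset.Icc (-(2 * N : ℤ)) (2 * N)).filter
      (fun h : ℤ => y + (h : ℝ) ∈ J)).card : ℕ) : ℝ≥0∞) ^ m := by
    calc ENNReal.ofReal (ℓ - 1) ^ m * volume J = ∫⁻ _ in J, ENNReal.ofReal (ℓ - 1) ^ m :=
          (setLIntegral_const _ _).symm
      _ ≤ _ := setLIntegral_mono' hJm fun y hy => by gcongr; exact hge y hy
  have htop : ENNReal.ofReal (ℓ + 1) ^ m * volume J ≠ ∞ :=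
    ENNReal.mul_ne_top (ENNReal.pow_ne_top ENNReal.ofReal_ne_top) hvolJ
  have hfin : ∫⁻ y in J, ((((Finset.Icc (-(2 * N : ℤ)) (2 * N)).filter
      (fun h : ℤ => y + (h : ℝ) ∈ J)).card : ℕ) : ℝ≥0∞) ^ m ≠ ∞ := ne_top_of_le_ne_top htop hup
  constructor
  · have h := ENNReal.toReal_mono hfin hlo
    rw [ENNReal.toReal_mul, ENNReal.toReal_pow, ENNReal.toReal_ofReal', hℓ] at h
    linarith
  · have h := ENNReal.toReal_mono htop hup
    rw [ENNReal.toReal_mul, ENNReal.toReal_pow, ENNReal.toReal_ofReal (by linarith), hℓ] at h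
    linarith

/-! ### Elementary real inequalities -/

/-- `a (a^m − b^m) ≤ m a^m` for `0 ≤ b ≤ a ≤ b + 1`. -/
theorem mul_pow_sub_pow_le {a b : ℝ} (hb : 0 ≤ b) (hba : b ≤ a) (hab : a - b ≤ 1) :
    ∀ n : ℕ, a * (a ^ n - b ^ n) ≤ n * a ^ n
  | 0 => by simp
  | n + 1 => by
    have ih := mul_pow_sub_pow_le hb hba hab n
    have ha : 0 ≤ a := hb.trans hba
    have hbn : b ^ n ≤ a ^ n := pow_le_pow_left₀ hb hba n
    have h1 : a * (a * (a ^ n - b ^ n)) ≤ a * (n * a ^ n) := mul_le_mul_of_nonneg_left ih ha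
    have h2 : a * (a - b) * b ^ n ≤ a * a ^ n := by
      have h3 : a * (a - b) ≤ a := by nlinarith
      calc a * (a - b) * b ^ n ≤ a * b ^ n := mul_le_mul_of_nonneg_right h3 (pow_nonneg hb n)
        _ ≤ a * a ^ n := mul_le_mul_of_nonneg_left hbn ha
    calc a * (a ^ (n + 1) - b ^ (n + 1)) = a * (a * (a ^ n - b ^ n)) + a * (a - b) * b ^ n := by ring
      _ ≤ a * (n * a ^ n) + a * a ^ n := add_le_add h1 h2
      _ = ((n + 1 : ℕ) : ℝ) * a ^ (n + 1) := by push_cast; ring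

/-- From `ℓ (ℓ-1)_+^m ≤ S ≤ ℓ (ℓ+1)^m`, `0 ≤ ℓ`, `ℓ + 1 ≤ K`: `|S − ℓ^{m+1}| ≤ m K^m`. -/
theorem abs_sub_pow_succ_le {S ℓ K : ℝ} {m : ℕ} (hℓ0 : 0 ≤ ℓ) (hℓK : ℓ + 1 ≤ K)
    (hlo : ℓ * max (ℓ - 1) 0 ^ m ≤ S) (hup : S ≤ ℓ * (ℓ + 1) ^ m) :
    |S - ℓ ^ (m + 1)| ≤ m * K ^ m := by
  have h4 : ℓ ^ (m + 1) = ℓ * ℓ ^ m := pow_succ' ℓ m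
  rw [abs_le]
  constructor
  · have hb0 : 0 ≤ max (ℓ - 1) 0 := le_max_right _ _
    have hbℓ : max (ℓ - 1) 0 ≤ ℓ := max_le (by linarith) hℓ0
    have hℓb : ℓ - max (ℓ - 1) 0 ≤ 1 := by
      have := le_max_left (ℓ - 1) 0
      linarith
    have h1 := mul_pow_sub_pow_le hb0 hbℓ hℓb m
    have h2 : ℓ ^ m ≤ K ^ m := pow_le_pow_left₀ hℓ0 (by linarith) m
    have h3 : (m : ℝ) * ℓ ^ m ≤ m * K ^ m := mul_le_mul_of_nonneg_left h2 (Nat.cast_nonneg m)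
    have h5 : ℓ * (ℓ ^ m - max (ℓ - 1) 0 ^ m) = ℓ * ℓ ^ m - ℓ * max (ℓ - 1) 0 ^ m := mul_sub _ _ _
    linarith
  · have h1 := mul_pow_sub_pow_le hℓ0 (by linarith : ℓ ≤ ℓ + 1) (by linarith : ℓ + 1 - ℓ ≤ 1) m
    have h2 : (ℓ + 1) ^ m ≤ K ^ m := pow_le_pow_left₀ (by linarith) hℓK m
    have h3 : (m : ℝ) * (ℓ + 1) ^ m ≤ m * K ^ m := mul_le_mul_of_nonneg_left h2 (Nat.cast_nonneg m)
    have h6 : ℓ ^ m ≤ (ℓ + 1) ^ m := pow_le_pow_left₀ hℓ0 (by linarith) m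
    have h5 : (ℓ + 1) * ((ℓ + 1) ^ m - ℓ ^ m) = (ℓ + 1) * (ℓ + 1) ^ m - (ℓ + 1) * ℓ ^ m := mul_sub _ _ _
    have h7 : ℓ * ((ℓ + 1) ^ m - ℓ ^ m) ≤ (ℓ + 1) * ((ℓ + 1) ^ m - ℓ ^ m) :=
      mul_le_mul_of_nonneg_right (by linarith) (by linarith)
    nlinarith [h1, h3, h7, hup, h4]

/-! ### B4 assembled -/

/-- (i) The average: `|∑_{H ∈ [-2N,2N]^m} vol(K_H) − vol(I)^{m+1}| ≤ m 2^m (N+1)^m` for a convex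
`I ⊆ [-N, N] ⊆ ℝ¹`. -/
theorem abs_sum_volume_meetTranslates_sub_le (m : ℕ) {I : Set (Fin 1 → ℝ)} (hI : Convex ℝ I) {N : ℕ}
    (hIN : I ⊆ realBox 1 N) :
    |∑ H ∈ shiftBox m N, (volume (meetTranslates I H)).toReal - (volume I).toReal ^ (m + 1)| ≤
      ((m : ℝ) * 2 ^ m) * ((N : ℝ) + 1) ^ m := by
  have hJ := ordConnected_section hI
  have hJN := section_subset_Icc hIN
  obtain ⟨hlo, hup⟩ := sum_volume_sections_bounds hJ hJN m
  have hS : ∑ H ∈ shiftBox m N, (volume (meetTranslates I H)).toReal =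
      ∑ H ∈ shiftBox m N, (volume {y : ℝ | ∀ j : Fin (m + 1), y + (shiftVec H j : ℝ) ∈
        {y : ℝ | (fun _ : Fin 1 => y) ∈ I}}).toReal :=
    Finset.sum_congr rfl fun H _ => by rw [meetTranslates_eq_preimage, volume_preimage_apply_zero]
  rw [hS, volume_eq_volume_section I]
  have hℓ0 : 0 ≤ (volume {y : ℝ | (fun _ : Fin 1 => y) ∈ I}).toReal := ENNReal.toReal_nonneg
  have hℓN : (volume {y : ℝ | (fun _ : Fin 1 => y) ∈ I}).toReal ≤ 2 * N := by
    have h := measure_mono (μ := volume) hJN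
    rw [Real.volume_Icc] at h
    have hN : (0 : ℝ) ≤ N := Nat.cast_nonneg N
    have h' := ENNReal.toReal_le_of_le_ofReal (by linarith) h
    linarith
  refine (abs_sub_pow_succ_le (K := 2 * ((N : ℝ) + 1)) hℓ0 (by linarith) hlo hup).trans (le_of_eq ?_)
  rw [mul_pow]
  ring

/-- (ii) The Lipschitz bound: `|vol(K_H) − vol(K_{H'})| ≤ 2 ∑_j |H_j − H'_j|` for a convex
`I ⊆ [-N, N] ⊆ ℝ¹`. -/
theorem abs_volume_meetTranslates_sub_le {I : Set (Fin 1 → ℝ)} (hI : Convex ℝ I) {N : ℕ}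
    (hIN : I ⊆ realBox 1 N) (H H' : Fin m → ℤ) :
    |(volume (meetTranslates I H)).toReal - (volume (meetTranslates I H')).toReal| ≤
      2 * ∑ j, |((H j : ℤ) : ℝ) - (H' j : ℝ)| := by
  have hJ := ordConnected_section hI
  have hJN := section_subset_Icc hIN
  have hvolJ : volume {y : ℝ | (fun _ : Fin 1 => y) ∈ I} ≠ ∞ := volume_ne_top_of_subset_Icc hJN
  have hfin : ∀ H'' : Fin m → ℤ, volume {y : ℝ | ∀ j : Fin (m + 1), y + (shiftVec H'' j : ℝ) ∈
      {y : ℝ | (fun _ : Fin 1 => y) ∈ I}} ≠ ∞ :=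
    fun H'' => measure_ne_top_of_subset (fun y hy => by simpa using hy 0) hvolJ
  rw [meetTranslates_eq_preimage, volume_preimage_apply_zero, meetTranslates_eq_preimage,
    volume_preimage_apply_zero]
  refine (abs_toReal_volume_sections_sub_le hJ (fun j => (shiftVec H j : ℝ)) (fun j => (shiftVec H' j : ℝ))
    (hfin H) (hfin H')).trans ?_
  rw [Fin.sum_univ_succ]
  simp only [shiftVec_zero, shiftVec_succ, Int.cast_zero, sub_zero, abs_zero, zero_add]
  have hnn : 0 ≤ ∑ j, |((H j : ℤ) : ℝ) - (H' j : ℝ)| := Finset.sum_nonneg fun _ _ => abs_nonneg _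
  linarith

/-- **B4 (`ArchFacts`) holds**: for a convex `I ⊆ [-N, N] ⊆ ℝ¹`, the volumes
`w(H) = vol(I ∩ ⋂_j (I − H_j))` satisfy `∑_{H ∈ [-2N,2N]^m} w(H) = vol(I)^{m+1} + O_m((N+1)^m)` (with the
constant `m 2^m`) and are `2`-Lipschitz in each shift `H_j`. -/
theorem stub_archFacts : ArchFacts := by
  intro m
  refine ⟨(m : ℝ) * 2 ^ m, fun N I hI hIN => ⟨?_, fun H H' => abs_volume_meetTranslates_sub_le hI hIN H H'⟩⟩
  exact abs_sum_volume_meetTranslates_sub_le m hI hIN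

end Summit.Parity.GeneralizedHardyLittlewood.Cruxes.RelativeDimOne.TranslateAmplification
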